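import Summits.QuantumFields.GaugeBoot.TiltedLinkRPCovariant
import Summits.QuantumFields.GaugeBoot.TiltedBoxLimitAxisRP
import Summits.QuantumFields.GaugeBoot.ZdCovariantLinkRP
import HarnessLib

/-!
# Covariant link RP of the 45°-tilted boxes along the axes `k ∉ {i, j}`, and the lift geometry near
the mirror (gauge-boot, tilted family, covariant link blocks 1/2)

HONEST FRAMING (cell `pub-gaugeboot`, page 1 of every file): the venture produces certified bounds
on lattice expectations at stated coupling, gauge group, dimension and torus size; NOT a mass gap,
NOT a continuum limit, NOT a string tension; NOT Yang–Mills-summit-bearing (barriers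
`FixedCouplingUltralocality`, `PerturbativeInvisibility`). Structural; bounds nothing.

## Content

`TiltedBoxLinkRP.lean` / `TiltedBoxLimitAxisRP.lean` gave the PLAIN link reflection positivity of
the tilted boxes `ℤ^d/Γ(M_u, M_v, 2Q)` and of their limit points (`tiltedBoxLimitPoints`, "Class T")
along every axis `k ∉ {i, j}`. With the covariant frame theorem
`IsSiteFrame.linkRP_nonneg_of_covariant` (`TiltedLinkRPCovariant.lean`) the same holds in the
COVARIANT (Osterwalder–Seiler half-link) form behind Kazakov–Zheng's cut-loop `R_link` blocks:

* `midSplice k Q h U Y` — the splice `splice_C(U, Y)` of a mid-plane frame as an instance-free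
  function (`midSplice_eq_splice`; it avoids carrying a `DecidableEq` instance of the abstract
  lattice into concrete instances), and `IsSiteFrame.linkRP_nonneg_of_covariant'` — the frame
  theorem of `TiltedLinkRPCovariant.lean` in this form;
* `tiltedBox_linkRP_of_covariant` — the box theorem (`k ∉ {i, j}`, `L = 2Q`, `Q ≥ 2`, `β ≥ 0`);
* lift geometry near the mirror `x_k = ½` (`|x_k| ≤ m`, `m + 1 ≤ Q`): the `Γ`-periodic lift
  `tiltedLift` intertwines the `ℤ^d` substitution `configCrossTranslate k` / splice
  `configCrossSplice k` (`ZdCovariantLinkRP.lean`) with the box's `midTranslate` /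
  `LatticeRP.splice (midCrossBlock …)` (`val_tiltedCoord_eq_zero_iff`,
  `isMidLowerLink_tiltedEdge_iff`, `not_isMidUpperLink_tiltedEdge`, `isMidCrossLink_tiltedEdge_iff`,
  `tiltedLift_midTranslate_apply`, `tiltedLift_midSplice_apply`, `apply_tiltedLift_midTranslate`,
  `apply_tiltedLift_midSplice`); coefficient cylinders supported on
  `linkHalfEdges k ∪ linkCrossEdges k` lift to observables of `P ∪ C`
  (`eqOn_comp_tiltedLift_posCross`);
* ★ `box_cov_nonneg` — the box step for lifted covariant `ℤ^d` data.

Sequel `TiltedBoxLimitCovariantLinkRP.lean`: `IsCovariantLinkRP k μ` for every tilted limit point,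
and the cut-loop `R_link` word blocks of Class T along `k ∉ {i, j}`. [folklore] mechanism
(Osterwalder–Seiler 1978 §2).
-/

noncomputable section

open MeasureTheory Filter Topology
open scoped ComplexOrder ComplexConjugate
open Literature.Probability.LatticeModels (Site)
open Literature.MathematicalPhysics.QuantumLattice
open Literature.MathematicalPhysics.QuantumFieldTheory (LatticeRP.splice)

namespace Summit.QuantumFields.GaugeBoot

namespace TiltedRP

/-! ## The splice of a mid-plane frame, instance-free -/

section MidSplice

variable {A : Type*} [AddCommGroup A] {d : ℕ} (k : Fin d) (Q : ℕ) (h : A →+ ZMod (2 * Q))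
  {G : Type*}

open scoped Classical in
/-- The spliced configuration of the mid-plane frame: crossing links from `Y`, all other links from
`U` (the function `LatticeRP.splice (midCrossBlock k Q h) (U, Y)`, written without a decidability
instance on the lattice so that it specialises verbatim to concrete boxes). -/
def midSplice (U Y : Config A d G) : Config A d G := fun l => if IsMidCrossLink k Q h l then Y l else U l

variable {k Q h}

/-- `midSplice` on a crossing link. -/
theorem midSplice_apply_of_isMidCrossLink (U Y : Config A d G) {l : Link A d}
    (hl : IsMidCrossLink k Q h l) : midSplice k Q h U Y l = Y l := by
  classical
  exact if_pos hl

/-- `midSplice` off the crossing links. -/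
theorem midSplice_apply_of_not_isMidCrossLink (U Y : Config A d G) {l : Link A d}
    (hl : ¬ IsMidCrossLink k Q h l) : midSplice k Q h U Y l = U l := by
  classical
  exact if_neg hl

/-- `midSplice` is the mechanism's `splice` along the crossing block. -/
theorem midSplice_eq_splice [Fintype A] [DecidableEq A] (U Y : Config A d G) :
    midSplice k Q h U Y = LatticeRP.splice (midCrossBlock k Q h) (U, Y) := by
  funext l
  by_cases hl : IsMidCrossLink k Q h l
  · rw [midSplice_apply_of_isMidCrossLink U Y hl, splice_apply_of_isMidCrossLink U Y hl]
  · rw [midSplice_apply_of_not_isMidCrossLink U Y hl, splice_apply_of_not_isMidCrossLink U Y hl]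

end MidSplice

/-! ## The frame theorem, instance-free form -/

section Frame

variable {A : Type*} [AddCommGroup A] [Fintype A] {d : ℕ}
variable {e : Fin d → A} {k : Fin d} {σ : A →+ A} {Q : ℕ} {h : A →+ ZMod (2 * Q)}
variable {N : ℕ} {G : Type*} [Group G] [TopologicalSpace G] [IsTopologicalGroup G] [CompactSpace G]
  [MeasurableSpace G] [BorelSpace G] [SecondCountableTopology G]
variable (ρ : G →* Matrix (Fin N) (Fin N) ℂ)

/-- **Covariant link RP of a mid-plane frame, `midSplice` form** (`TiltedLinkRPCovariant.lean`). -/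
theorem IsSiteFrame.linkRP_nonneg_of_covariant' (hF : IsSiteFrame e k σ Q h) (hρ : Continuous ρ)
    {β : ℝ} (hβ : 0 ≤ β) {K : Type*} [Fintype K] {g : K → Config A d G → ℂ}
    (hgm : ∀ κ, Measurable (g κ)) {Kg : ℝ} (hgb : ∀ κ U, ‖g κ U‖ ≤ Kg)
    (hgdep : ∀ κ (U V : Config A d G),
      (∀ l, IsMidPosLink e Q h l ∨ IsMidCrossLink k Q h l → U l = V l) → g κ U = g κ V)
    {Φ : Config A d G → ℂ} (hΦm : Measurable Φ)
    (hcov : ∀ U Y, Φ (midTranslate k Q h Y U) =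
      ∑ κ, g κ (midSplice k Q h U Y) * conj (g κ (configMidReflect e k σ U))) :
    0 ≤ ∫ U, Φ U ∂(gibbs ρ e β) := by
  classical
  exact hF.linkRP_nonneg_of_covariant ρ hρ hβ hgm hgb hgdep hΦm fun U Y => by
    rw [hcov U Y]
    simp only [midSplice_eq_splice]

end Frame

/-! ## The box theorem -/

section Box

variable {d : ℕ} {i j k : Fin d} {Mu Mv Q N : ℕ} [NeZero Mu] [NeZero Mv] [NeZero Q]
variable {G : Type*} [Group G] [TopologicalSpace G] [IsTopologicalGroup G] [CompactSpace G]
  [MeasurableSpace G] [BorelSpace G] [SecondCountableTopology G]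
variable (ρ : G →* Matrix (Fin N) (Fin N) ℂ)

/-- **Covariant link RP of the tilted box along `k ∉ {i, j}`** (`L = 2Q`, `Q ≥ 2`, `β ≥ 0`,
compact second countable `G`, continuous `ρ`): for bounded measurable `g_κ` depending only on
the positive and crossing links of the mirror `x_k = ½` and a measurable `Φ` with
`Φ (midTranslate Y U) = Σ_κ g_κ(splice_C(U, Y)) · conj g_κ(ΘU)`: `0 ≤ ∫ Φ dμ_β`. -/
theorem tiltedBox_linkRP_of_covariant (hki : k ≠ i) (hkj : k ≠ j) (hQ : 2 ≤ Q) (hρ : Continuous ρ)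
    {β : ℝ} (hβ : 0 ≤ β) {K : Type*} [Fintype K]
    {g : K → Config (TiltedSite d i j Mu Mv (2 * Q)) d G → ℂ} (hgm : ∀ κ, Measurable (g κ))
    {Kg : ℝ} (hgb : ∀ κ U, ‖g κ U‖ ≤ Kg)
    (hgdep : ∀ κ (U V : Config (TiltedSite d i j Mu Mv (2 * Q)) d G),
      (∀ l, IsMidPosLink (tiltedUnit d i j Mu Mv (2 * Q)) Q (tiltedCoord d Mu Mv (2 * Q) hki hkj) l ∨
        IsMidCrossLink k Q (tiltedCoord d Mu Mv (2 * Q) hki hkj) l → U l = V l) → g κ U = g κ V)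
    {Φ : Config (TiltedSite d i j Mu Mv (2 * Q)) d G → ℂ} (hΦm : Measurable Φ)
    (hcov : ∀ U Y, Φ (midTranslate k Q (tiltedCoord d Mu Mv (2 * Q) hki hkj) Y U) =
      ∑ κ, g κ (midSplice k Q (tiltedCoord d Mu Mv (2 * Q) hki hkj) U Y) *
        conj (g κ (configMidReflect (tiltedUnit d i j Mu Mv (2 * Q)) k
          (tiltedReflect d Mu Mv (2 * Q) hki hkj) U))) :
    0 ≤ ∫ U, Φ U ∂(gibbs ρ (tiltedUnit d i j Mu Mv (2 * Q)) β) :=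
  (isSiteFrame_tiltedBox d Mu Mv hki hkj hQ).linkRP_nonneg_of_covariant' ρ hρ hβ hgm hgb hgdep hΦm
    hcov

end Box

/-! ## Lift geometry near the mirror `x_k = ½` -/

section Geometry

variable {d : ℕ} {i j k : Fin d} {Mu Mv Q : ℕ} [NeZero Q] {G : Type*}

/-- The coordinate `x_k mod 2Q` of a class with `-2Q ≤ x_k < 0`, read in `[0, 2Q)`, is `x_k + 2Q`. -/
theorem val_tiltedCoord_mk_of_neg (hki : k ≠ i) (hkj : k ≠ j) {x : Site d} (h0 : x k < 0)
    (hL : -((2 * Q : ℕ) : ℤ) ≤ x k) :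
    ((tiltedCoord d Mu Mv (2 * Q) hki hkj (x : TiltedSite d i j Mu Mv (2 * Q))).val : ℤ) =
      x k + (2 * Q : ℕ) := by
  haveI : NeZero (2 * Q) := ⟨by have := NeZero.ne Q; omega⟩
  rw [tiltedCoord_mk, ZMod.val_intCast]
  have h1 : (x k + (2 * Q : ℕ)) % ((2 * Q : ℕ) : ℤ) = x k + (2 * Q : ℕ) :=
    Int.emod_eq_of_lt (by omega) (by omega)
  rw [← h1, Int.add_emod_right]

/-- **Near the mirror the box sees the layers of `ℤ^d`**: for `-m ≤ x_k ≤ m`, `m + 1 ≤ Q`, the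
height of `[x]` is `0` iff `x_k = 0`, and it is never `Q` (the upper crossing layer is out of reach). -/
theorem val_tiltedCoord_eq_zero_iff (hki : k ≠ i) (hkj : k ≠ j) {x : Site d} {m : ℕ}
    (h1 : -(m : ℤ) ≤ x k) (h2 : x k ≤ m) (hmQ : m + 1 ≤ Q) :
    ((tiltedCoord d Mu Mv (2 * Q) hki hkj (x : TiltedSite d i j Mu Mv (2 * Q))).val = 0 ↔ x k = 0) ∧
      (tiltedCoord d Mu Mv (2 * Q) hki hkj (x : TiltedSite d i j Mu Mv (2 * Q))).val ≠ Q := by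
  haveI : NeZero (2 * Q) := ⟨by have := NeZero.ne Q; omega⟩
  rcases lt_or_ge (x k) 0 with hneg | hpos
  · have hv := val_tiltedCoord_mk_of_neg (Mu := Mu) (Mv := Mv) (Q := Q) hki hkj hneg
      (by push_cast; omega)
    refine ⟨⟨fun h => ?_, fun h => ?_⟩, fun h => ?_⟩
    · have : ((tiltedCoord d Mu Mv (2 * Q) hki hkj (x : TiltedSite d i j Mu Mv (2 * Q))).val : ℤ) = 0 := by
        exact_mod_cast h
      push_cast at hv; omega
    · omega
    · have : ((tiltedCoord d Mu Mv (2 * Q) hki hkj (x : TiltedSite d i j Mu Mv (2 * Q))).val : ℤ) = Q := by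
        exact_mod_cast h
      push_cast at hv; omega
  · have hv := val_tiltedCoord_mk (Mu := Mu) (Mv := Mv) (L := 2 * Q) hki hkj (x := x) hpos
      (by push_cast; omega)
    refine ⟨⟨fun h => ?_, fun h => ?_⟩, fun h => ?_⟩
    · have : ((tiltedCoord d Mu Mv (2 * Q) hki hkj (x : TiltedSite d i j Mu Mv (2 * Q))).val : ℤ) = 0 := by
        exact_mod_cast h
      omega
    · have : ((tiltedCoord d Mu Mv (2 * Q) hki hkj (x : TiltedSite d i j Mu Mv (2 * Q))).val : ℤ) = 0 := by
        omega
      exact_mod_cast this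
    · have : ((tiltedCoord d Mu Mv (2 * Q) hki hkj (x : TiltedSite d i j Mu Mv (2 * Q))).val : ℤ) = Q := by
        exact_mod_cast h
      omega

/-- The box link below a `ℤ^d` link near the mirror is a lower crossing link of the box's mid-plane
frame iff the link crosses `x_k = ½`. -/
theorem isMidLowerLink_tiltedEdge_iff (hki : k ≠ i) (hkj : k ≠ j) {e : ZdEdge d} {m : ℕ}
    (h1 : -(m : ℤ) ≤ e.1 k) (h2 : e.1 k ≤ m) (hmQ : m + 1 ≤ Q) :
    IsMidLowerLink k Q (tiltedCoord d Mu Mv (2 * Q) hki hkj) (tiltedEdge d i j Mu Mv (2 * Q) e) ↔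
      e ∈ linkCrossEdges k := by
  simp only [IsMidLowerLink, tiltedEdge_apply, mem_linkCrossEdges,
    (val_tiltedCoord_eq_zero_iff (Mu := Mu) (Mv := Mv) hki hkj h1 h2 hmQ).1]

/-- Near the mirror no lifted link is an upper crossing link of the box. -/
theorem not_isMidUpperLink_tiltedEdge (hki : k ≠ i) (hkj : k ≠ j) {e : ZdEdge d} {m : ℕ}
    (h1 : -(m : ℤ) ≤ e.1 k) (h2 : e.1 k ≤ m) (hmQ : m + 1 ≤ Q) :
    ¬ IsMidUpperLink k Q (tiltedCoord d Mu Mv (2 * Q) hki hkj) (tiltedEdge d i j Mu Mv (2 * Q) e) :=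
  fun h => (val_tiltedCoord_eq_zero_iff (Mu := Mu) (Mv := Mv) hki hkj h1 h2 hmQ).2 h.2

/-- The box link below a `ℤ^d` link near the mirror is a crossing link iff the link crosses
`x_k = ½`. -/
theorem isMidCrossLink_tiltedEdge_iff (hki : k ≠ i) (hkj : k ≠ j) {e : ZdEdge d} {m : ℕ}
    (h1 : -(m : ℤ) ≤ e.1 k) (h2 : e.1 k ≤ m) (hmQ : m + 1 ≤ Q) :
    IsMidCrossLink k Q (tiltedCoord d Mu Mv (2 * Q) hki hkj) (tiltedEdge d i j Mu Mv (2 * Q) e) ↔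
      e ∈ linkCrossEdges k := by
  rw [isMidCrossLink_iff]
  constructor
  · rintro (h | h)
    · exact (isMidLowerLink_tiltedEdge_iff hki hkj h1 h2 hmQ).1 h
    · exact absurd h (not_isMidUpperLink_tiltedEdge hki hkj h1 h2 hmQ)
  · intro h
    exact Or.inl ((isMidLowerLink_tiltedEdge_iff hki hkj h1 h2 hmQ).2 h)

variable [Group G]

/-- **The lift intertwines the substitutions** (near the mirror): on links with `|x_k| ≤ m`,
`m + 1 ≤ Q`, `tiltedLift (midTranslate Y V) = configCrossTranslate k (tiltedLift Y) (tiltedLift V)`. -/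
theorem tiltedLift_midTranslate_apply (hki : k ≠ i) (hkj : k ≠ j)
    (Y V : Config (TiltedSite d i j Mu Mv (2 * Q)) d G) {e : ZdEdge d} {m : ℕ}
    (h1 : -(m : ℤ) ≤ e.1 k) (h2 : e.1 k ≤ m) (hmQ : m + 1 ≤ Q) :
    tiltedLift d i j Mu Mv (2 * Q) (midTranslate k Q (tiltedCoord d Mu Mv (2 * Q) hki hkj) Y V) e =
      configCrossTranslate k (tiltedLift d i j Mu Mv (2 * Q) Y) (tiltedLift d i j Mu Mv (2 * Q) V) e := by
  classical
  have hup := not_isMidUpperLink_tiltedEdge (Mu := Mu) (Mv := Mv) hki hkj h1 h2 hmQ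
  by_cases he : e ∈ linkCrossEdges (d := d) k
  · have hlow := (isMidLowerLink_tiltedEdge_iff (Mu := Mu) (Mv := Mv) hki hkj h1 h2 hmQ).2 he
    rw [configCrossTranslate_apply_of_mem _ _ he]
    simp only [tiltedLift, midTranslate, if_pos hlow, if_neg hup, one_mul]
  · rw [configCrossTranslate_apply_of_not_mem _ _ he]
    exact midTranslate_apply_of_not_isMidCrossLink Y V
      (mt (isMidCrossLink_tiltedEdge_iff (Mu := Mu) (Mv := Mv) hki hkj h1 h2 hmQ).1 he)

variable [NeZero Mu] [NeZero Mv]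

omit [Group G] [NeZero Mu] [NeZero Mv] in
/-- **The lift intertwines the splices** (near the mirror). -/
theorem tiltedLift_midSplice_apply (hki : k ≠ i) (hkj : k ≠ j)
    (V Y : Config (TiltedSite d i j Mu Mv (2 * Q)) d G) {e : ZdEdge d} {m : ℕ}
    (h1 : -(m : ℤ) ≤ e.1 k) (h2 : e.1 k ≤ m) (hmQ : m + 1 ≤ Q) :
    tiltedLift d i j Mu Mv (2 * Q) (midSplice k Q (tiltedCoord d Mu Mv (2 * Q) hki hkj) V Y) e =
      configCrossSplice k (tiltedLift d i j Mu Mv (2 * Q) V) (tiltedLift d i j Mu Mv (2 * Q) Y) e := by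
  by_cases he : e ∈ linkCrossEdges (d := d) k
  · rw [configCrossSplice_apply_of_mem _ _ he]
    exact midSplice_apply_of_isMidCrossLink V Y
      ((isMidCrossLink_tiltedEdge_iff (Mu := Mu) (Mv := Mv) hki hkj h1 h2 hmQ).2 he)
  · rw [configCrossSplice_apply_of_not_mem _ _ he]
    exact midSplice_apply_of_not_isMidCrossLink V Y
      (mt (isMidCrossLink_tiltedEdge_iff (Mu := Mu) (Mv := Mv) hki hkj h1 h2 hmQ).1 he)

omit [NeZero Mu] [NeZero Mv] in
/-- Cylinder form of `tiltedLift_midTranslate_apply`: a cylinder observable supported on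
`|x_k| ≤ m` reads the lifted substitution as the `ℤ^d` substitution of the lifts. -/
theorem apply_tiltedLift_midTranslate (hki : k ≠ i) (hkj : k ≠ j) {α : Type*}
    {F : LGConfig d G → α} {S : Finset (ZdEdge d)} (hF : IsCylinder F S) {m : ℕ}
    (hS : ∀ e ∈ S, -(m : ℤ) ≤ e.1 k ∧ e.1 k ≤ m) (hmQ : m + 1 ≤ Q)
    (Y V : Config (TiltedSite d i j Mu Mv (2 * Q)) d G) :
    F (tiltedLift d i j Mu Mv (2 * Q) (midTranslate k Q (tiltedCoord d Mu Mv (2 * Q) hki hkj) Y V)) =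
      F (configCrossTranslate k (tiltedLift d i j Mu Mv (2 * Q) Y) (tiltedLift d i j Mu Mv (2 * Q) V)) :=
  hF fun e he => tiltedLift_midTranslate_apply hki hkj Y V (hS e he).1 (hS e he).2 hmQ

omit [Group G] [NeZero Mu] [NeZero Mv] in
/-- Cylinder form of `tiltedLift_midSplice_apply`. -/
theorem apply_tiltedLift_midSplice (hki : k ≠ i) (hkj : k ≠ j) {α : Type*}
    {F : LGConfig d G → α} {S : Finset (ZdEdge d)} (hF : IsCylinder F S) {m : ℕ}
    (hS : ∀ e ∈ S, -(m : ℤ) ≤ e.1 k ∧ e.1 k ≤ m) (hmQ : m + 1 ≤ Q)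
    (V Y : Config (TiltedSite d i j Mu Mv (2 * Q)) d G) :
    F (tiltedLift d i j Mu Mv (2 * Q) (midSplice k Q (tiltedCoord d Mu Mv (2 * Q) hki hkj) V Y)) =
      F (configCrossSplice k (tiltedLift d i j Mu Mv (2 * Q) V) (tiltedLift d i j Mu Mv (2 * Q) Y)) :=
  hF fun e he => tiltedLift_midSplice_apply hki hkj V Y (hS e he).1 (hS e he).2 hmQ

omit [Group G] [NeZero Mu] [NeZero Mv] in
/-- **Coefficient cylinders of `linkHalfEdges k ∪ linkCrossEdges k` lift to observables of
`P ∪ C`** of every box with `Q ≥ m + 1` (`x_k ≤ m` on the support). -/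
theorem eqOn_comp_tiltedLift_posCross (hki : k ≠ i) (hkj : k ≠ j) {α : Type*}
    {g : LGConfig d G → α} {T : Finset (ZdEdge d)} (hg : IsCylinder g T)
    (hT : (↑T : Set (ZdEdge d)) ⊆ linkHalfEdges k ∪ linkCrossEdges k) {m : ℕ}
    (hTm : ∀ e ∈ T, e.1 k ≤ m) (hmQ : m + 1 ≤ Q) (U V : Config (TiltedSite d i j Mu Mv (2 * Q)) d G)
    (hUV : ∀ l, IsMidPosLink (tiltedUnit d i j Mu Mv (2 * Q)) Q (tiltedCoord d Mu Mv (2 * Q) hki hkj) l ∨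
      IsMidCrossLink k Q (tiltedCoord d Mu Mv (2 * Q) hki hkj) l → U l = V l) :
    g (tiltedLift d i j Mu Mv (2 * Q) U) = g (tiltedLift d i j Mu Mv (2 * Q) V) := by
  haveI : NeZero (2 * Q) := ⟨by have := NeZero.ne Q; omega⟩
  refine hg fun e he => ?_
  simp only [tiltedLift_apply]
  rcases hT he with hh | hc
  · -- a link of the closed half: a positive link of the box
    refine hUV _ (Or.inl ?_)
    have hmem : 1 ≤ e.1 k := hh
    have hm := hTm e (Finset.mem_coe.1 he)
    refine ⟨?_, ?_⟩
    · show 1 ≤ (tiltedCoord d Mu Mv (2 * Q) hki hkj (e.1 : TiltedSite d i j Mu Mv (2 * Q))).val ∧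
        (tiltedCoord d Mu Mv (2 * Q) hki hkj (e.1 : TiltedSite d i j Mu Mv (2 * Q))).val ≤ Q
      have h := val_tiltedCoord_mk (Mu := Mu) (Mv := Mv) (L := 2 * Q) hki hkj (x := e.1)
        (by omega) (by push_cast; omega)
      constructor <;> omega
    · show 1 ≤ (tiltedCoord d Mu Mv (2 * Q) hki hkj
          ((e.1 : TiltedSite d i j Mu Mv (2 * Q)) + tiltedUnit d i j Mu Mv (2 * Q) e.2)).val ∧
        (tiltedCoord d Mu Mv (2 * Q) hki hkj
          ((e.1 : TiltedSite d i j Mu Mv (2 * Q)) + tiltedUnit d i j Mu Mv (2 * Q) e.2)).val ≤ Q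
      rw [← mk_add_single]
      obtain ⟨h0, h1⟩ := coord_endpoint_bounds (k := k) (e := e) (by omega) hm
      have h1' : 1 ≤ (e.1 + Pi.single e.2 (1 : ℤ) : Site d) k := by
        simp only [Pi.add_apply, Pi.single_apply]
        split_ifs <;> omega
      have h := val_tiltedCoord_mk (Mu := Mu) (Mv := Mv) (L := 2 * Q) (i := i) (j := j) hki hkj h0
        (by push_cast; omega)
      constructor <;> omega
  · -- a crossing link of `ℤ^d`: a lower crossing link of the box
    refine hUV _ (Or.inr ?_)
    have hb : -(m : ℤ) ≤ e.1 k ∧ e.1 k ≤ m := by rw [hc.2]; constructor <;> omega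
    exact ((isMidLowerLink_tiltedEdge_iff (Mu := Mu) (Mv := Mv) hki hkj hb.1 hb.2 hmQ).2 hc).isMidCrossLink

end Geometry

/-! ## The box step for lifted covariant data -/

section BoxStep

variable {d : ℕ} {i j k : Fin d} {Mu Mv Q N : ℕ} [NeZero Mu] [NeZero Mv] [NeZero Q]
variable {G : Type*} [Group G] [TopologicalSpace G] [IsTopologicalGroup G] [CompactSpace G]
  [MeasurableSpace G] [BorelSpace G] [SecondCountableTopology G]
variable (ρ : G →* Matrix (Fin N) (Fin N) ℂ)

/-- ★ **Box step.** On a tilted box of transverse period `2Q`, `Q ≥ 2`, `Q ≥ m + 1`, the lift of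
covariant `ℤ^d` data of the mirror `x_k = ½` (`k ∉ {i, j}`; coefficients `g_κ` supported on
`linkHalfEdges k ∪ linkCrossEdges k` with `x_k ≤ m`, `Φ` supported on `|x_k| ≤ m`) has non-negative
expectation in the box's Wilson measure (`β ≥ 0`). -/
theorem box_cov_nonneg (hki : k ≠ i) (hkj : k ≠ j) (hQ : 2 ≤ Q) (hρ : Continuous ρ) {β : ℝ}
    (hβ : 0 ≤ β) {n : ℕ} {g : Fin n → LGConfig d G → ℂ} {T : Finset (ZdEdge d)}
    (hT : (↑T : Set (ZdEdge d)) ⊆ linkHalfEdges k ∪ linkCrossEdges k) (hgm : ∀ κ, Measurable (g κ))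
    (hgT : ∀ κ, IsCylinder (g κ) T) {Cg : ℝ} (hCg : ∀ κ U, ‖g κ U‖ ≤ Cg)
    {Φ : LGConfig d G → ℂ} {S : Finset (ZdEdge d)} (hΦS : IsCylinder Φ S) (hΦm : Measurable Φ)
    (hcov : ∀ U Y, Φ (configCrossTranslate k Y U) =
      ∑ κ, g κ (configCrossSplice k U Y) * conj (g κ (configLinkReflect k U)))
    {m : ℕ} (hSm : ∀ e ∈ S, -(m : ℤ) ≤ e.1 k ∧ e.1 k ≤ m) (hTm : ∀ e ∈ T, e.1 k ≤ m)
    (hmQ : m + 1 ≤ Q) :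
    0 ≤ ∫ U, Φ (tiltedLift d i j Mu Mv (2 * Q) U) ∂(gibbs ρ (tiltedUnit d i j Mu Mv (2 * Q)) β) := by
  classical
  have hTb : ∀ e ∈ T, -(m : ℤ) ≤ e.1 k ∧ e.1 k ≤ m := fun e he => by
    refine ⟨?_, hTm e he⟩
    rcases hT (Finset.mem_coe.2 he) with hh | hc
    · have : (1 : ℤ) ≤ e.1 k := hh
      omega
    · rw [hc.2]; omega
  refine tiltedBox_linkRP_of_covariant ρ hki hkj hQ hρ hβ
    (g := fun κ U => g κ (tiltedLift d i j Mu Mv (2 * Q) U))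
    (fun κ => (hgm κ).comp (measurable_tiltedLift d i j Mu Mv (2 * Q)))
    (fun κ U => hCg κ _)
    (fun κ U V hUV => eqOn_comp_tiltedLift_posCross hki hkj (hgT κ) hT hTm hmQ U V hUV)
    (hΦm.comp (measurable_tiltedLift d i j Mu Mv (2 * Q))) fun U Y => ?_
  show Φ (tiltedLift d i j Mu Mv (2 * Q) _) = _
  rw [apply_tiltedLift_midTranslate hki hkj hΦS hSm hmQ, hcov]
  refine Finset.sum_congr rfl fun κ _ => ?_
  rw [apply_tiltedLift_midSplice hki hkj (hgT κ) hTb hmQ, tiltedLift_configMidReflect]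

end BoxStep

end TiltedRP

end Summit.QuantumFields.GaugeBoot
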